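import Summits.CriticalPhenomena.CardyFormulaZ2.Theorems.CardySelfDualSegmentUniformMarginalityReduction
import Summits.CriticalPhenomena.CardyFormulaZ2.Theorems.CardySelfDualSegmentUniformMarginalityWildFromRectilinear

/-!
# Crux `UniformMarginality` (stmt-CriticalPhenomena-5472): the typed three-way SPLIT of the crux
(crux-strategist `cstrat-stmt-CriticalPhenomena-5472-s1`, route `CardySelfDualSegment`)

`UniformMarginality_of_subs : Sub₁ → Sub₂ → Sub₃ → CardySelfDualSegment.UniformMarginality`, the three
sub-statements written in the EXACT `let`-style of the gate-rendered route file
`Summits/CriticalPhenomena/CardyFormulaZ2/Theses/CardySelfDualSegment.lean` (so that they can be filed as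
split children of the crux, `ledger route edit … --split UniformMarginality --into children.json` with
`--glue-by` this theorem once a PROVER has re-filed this file as
`Theorems/CardySelfDualSegmentUniformMarginalitySplit.lean --supports stmt-CriticalPhenomena-5472` — planners
cannot write `Theorems/`; until then `--glue "<informal>"` generates a glue support item that this file closes.
STATUS 2026-08-17: the strategist's own `--split` was bounced by the gate's final-cycle-only rule; the package
(children.json, commands) is `Cruxes/UniformMarginality/StrategistSplit.md`, the census `STRATEGY-CENSUS.md`):

* Sub₁ `UniformMarginalityRect` — QUANTITATIVE MARGINALITY ON RECTILINEAR CONFORMAL RECTANGLES: the crux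
  with the hypothesis "the boundary of `R` is covered by finitely many axis-parallel segments" inserted
  (text = `Restatement.UniformMarginalityRect` of the lead's certificate `Lines/Sketch_restatement.lean`;
  literally stub (B₁) `stub_integratedBoundRectilinear` of line `Sketch`, by
  `uniformMarginalityRect_iff_integratedBoundRectilinear`, p137344). All the `t`-uniform (marginality)
  content of the crux; none of its wild-boundary content (Disproof.lean §3: the modulus `η` of the crux
  is not shape-uniform precisely through lattice-scale boundary combs, which the hypothesis excludes).
* Sub₂ `FixedDomainContinuityInterior` — SINGLE-MODEL a-priori domain continuity at a wild centre, OPEN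
  parameter interval: for `0 < t₀ < 1`, crude `M_{t₀}`-crossing probabilities of rectilinear `Q`
  `ε₀`-close to `R` (boundary loop and marks) are `ε`-close to those of `R` below a mesh threshold
  (stub (B₂ᵒ); Schramm–Smirnov 2011 Lemma 5.1 for the corner model `M_{t₀}`; needs RSW for `M_{t₀}`).
* Sub₃ `FixedDomainContinuityOne` — the same at the bond-`ℤ²` endpoint `t₀ = 1` (stub (N); provable now
  from `SchrammSmirnov2011_lemma_5_1_holds`, the CardyIKTransport Freeze bridge and `cornerPercolation_one`).

Proof = the composition of the lead's skeleton v9 (`Cruxes/UniformMarginality/Lines/Sketch.lean`) with its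
three stubs turned into hypotheses, after translating the route `let`-forms (`unitInterval`, `dist`,
`P = cornerCrossingProb` syntactically) into the line's forms (real parameters, `Pext`, `Pext_coe`):
the landed `t₀ = 0` kernel `fixedDomainContinuity_zero` (p116559) + Sub₃ + Sub₂ give the fixed-parameter
kernel on `[0,1]` by cases; `stub_uniformSandwichOfFixedDomainContinuity` (p116281),
`stub_transportOfUniformSandwich` (p111792) and `uniformMarginality_of_integratedBound` (p96304) conclude
the route decl BY NAME. Nothing here is new mathematics; the file exists so that the split glue can become a
LANDED theorem (D-0019 glued split, `--glue-by`). `lean check`: rc 0, sorries 0; the by-cases lemma is named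
`fixedDomainContinuity_byCases` so as not to pre-empt the lead's registered stub `fixedDomainContinuity_of_cases`.
-/

noncomputable section

namespace Summit.CriticalPhenomena.CardyFormulaZ2.Cruxes.UniformMarginality.HeatFlow.Split

open Literature.Probability.Percolation Literature.Probability.LatticeModels
  Literature.Probability.RandomPlanarGeometry

/-- The fixed-parameter kernel on `[0,1]` BY CASES `t₀ ∈ {0} ∪ (0,1) ∪ {1}` (the lead's v9 glue
`fixedDomainContinuity_of_cases`, re-proved here under a different name so that the split glue depends on
landed files only and does not pre-empt the lead's registered stub of that name). -/
theorem fixedDomainContinuity_byCases :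
    (∀ (R : ConformalRectangle) (ε : ℝ), 0 < ε → ∃ ε₀ > 0, ∀ Q : ConformalRectangle,
        (∃ S : Finset (ℂ × ℂ), (∀ p ∈ S, p.1.re = p.2.re ∨ p.1.im = p.2.im) ∧
          frontier Q.carrier ⊆ ⋃ p ∈ S, segment ℝ p.1 p.2) →
        (∀ u : ℝ, dist (Q.boundary u) (R.boundary u) ≤ ε₀) → (∀ i : Fin 4, |Q.mark i - R.mark i| ≤ ε₀) →
        ∃ δ₀ > 0, ∀ δ : ℝ, 0 < δ → δ < δ₀ → |Pext Q δ 0 - Pext R δ 0| ≤ ε) →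
    (∀ (R : ConformalRectangle) (ε : ℝ), 0 < ε → ∃ ε₀ > 0, ∀ Q : ConformalRectangle,
        (∃ S : Finset (ℂ × ℂ), (∀ p ∈ S, p.1.re = p.2.re ∨ p.1.im = p.2.im) ∧
          frontier Q.carrier ⊆ ⋃ p ∈ S, segment ℝ p.1 p.2) →
        (∀ u : ℝ, dist (Q.boundary u) (R.boundary u) ≤ ε₀) → (∀ i : Fin 4, |Q.mark i - R.mark i| ≤ ε₀) →
        ∃ δ₀ > 0, ∀ δ : ℝ, 0 < δ → δ < δ₀ → |Pext Q δ 1 - Pext R δ 1| ≤ ε) →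
    (∀ (R : ConformalRectangle) (t₀ : ℝ), t₀ ∈ Set.Ioo (0 : ℝ) 1 → ∀ ε : ℝ, 0 < ε → ∃ ε₀ > 0, ∀ Q : ConformalRectangle,
        (∃ S : Finset (ℂ × ℂ), (∀ p ∈ S, p.1.re = p.2.re ∨ p.1.im = p.2.im) ∧
          frontier Q.carrier ⊆ ⋃ p ∈ S, segment ℝ p.1 p.2) →
        (∀ u : ℝ, dist (Q.boundary u) (R.boundary u) ≤ ε₀) → (∀ i : Fin 4, |Q.mark i - R.mark i| ≤ ε₀) →
        ∃ δ₀ > 0, ∀ δ : ℝ, 0 < δ → δ < δ₀ → |Pext Q δ t₀ - Pext R δ t₀| ≤ ε) →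
    ∀ (R : ConformalRectangle) (t₀ : ℝ), t₀ ∈ Set.Icc (0 : ℝ) 1 → ∀ ε : ℝ, 0 < ε → ∃ ε₀ > 0, ∀ Q : ConformalRectangle,
        (∃ S : Finset (ℂ × ℂ), (∀ p ∈ S, p.1.re = p.2.re ∨ p.1.im = p.2.im) ∧
          frontier Q.carrier ⊆ ⋃ p ∈ S, segment ℝ p.1 p.2) →
        (∀ u : ℝ, dist (Q.boundary u) (R.boundary u) ≤ ε₀) → (∀ i : Fin 4, |Q.mark i - R.mark i| ≤ ε₀) →
        ∃ δ₀ > 0, ∀ δ : ℝ, 0 < δ → δ < δ₀ → |Pext Q δ t₀ - Pext R δ t₀| ≤ ε := by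
  intro h0 h1 hint R t₀ ht₀ ε hε
  rcases eq_or_lt_of_le ht₀.1 with h | h
  · subst h
    exact h0 R ε hε
  rcases eq_or_lt_of_le ht₀.2 with h' | h'
  · subst h'
    exact h1 R ε hε
  · exact hint R t₀ ⟨h, h'⟩ ε hε

/-- **The split glue** `Sub₁ → Sub₂ → Sub₃ → UniformMarginality`, each child written in the route's
`let`-style (own copy of the route prefix `prm`, `cfg`, `P`, exactly as the gate renders route items):
Sub₁ = `UniformMarginalityRect` (crux; the text of `Restatement.UniformMarginalityRect`, = stub (B₁)),
Sub₂ = `FixedDomainContinuityInterior` (crux; = stub (B₂ᵒ)), Sub₃ = `FixedDomainContinuityOne` (support,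
provable now; = stub (N)). Conclusion = the route decl by name. -/
theorem UniformMarginality_of_subs :
    (let prm : unitInterval → Literature.Probability.LatticeModels.Site 2 × Fin 2 → unitInterval := fun t i => if i.2 = 0 then Literature.Probability.Percolation.half else Literature.Probability.Percolation.half * t; let cfg : Set (Literature.Probability.LatticeModels.Site 2 × Fin 2) → Literature.Probability.Percolation.BondConfig (Literature.Probability.LatticeModels.Site 2) := fun S => {e | ∃ v : Literature.Probability.LatticeModels.Site 2, (e = s(v, v + ![1, 0]) ∧ (v, (0 : Fin 2)) ∈ S) ∨ (e = s(v, v + ![0, 1]) ∧ ((v, (0 : Fin 2)) ∈ S ↔ (v, (1 : Fin 2)) ∉ S))}; let P : unitInterval → Literature.Probability.RandomPlanarGeometry.ConformalRectangle → ℝ → ℝ := fun t R δ => (Literature.Probability.LatticeModels.prodBernoulli (prm t)).real {S | cfg S ∈ Literature.Probability.Percolation.embDomainCrossing Literature.Probability.LatticeModels.squareLatticeEmbedding.z R.carrier δ (R.arc 0) (R.arc 2)}; (∀ (t₀ : unitInterval) (R : Literature.Probability.RandomPlanarGeometry.ConformalRectangle), (∃ S : Finset (ℂ × ℂ), (∀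 p ∈ S, p.1.re = p.2.re ∨ p.1.im = p.2.im) ∧ frontier R.carrier ⊆ ⋃ p ∈ S, segment ℝ p.1 p.2) → ∀ (ε : ℝ), 0 < ε → ∃ η > 0, ∀ t : unitInterval, dist t t₀ < η → ∀ δ : ℝ, 0 < δ → |P t R δ - P t₀ R δ| < ε)) →
    (let prm : unitInterval → Literature.Probability.LatticeModels.Site 2 × Fin 2 → unitInterval := fun t i => if i.2 = 0 then Literature.Probability.Percolation.half else Literature.Probability.Percolation.half * t; let cfg : Set (Literature.Probability.LatticeModels.Site 2 × Fin 2) → Literature.Probability.Percolation.BondConfig (Literature.Probability.LatticeModels.Site 2) := fun S => {e | ∃ v : Literature.Probability.LatticeModels.Site 2, (e = s(v, v + ![1, 0]) ∧ (v, (0 : Fin 2)) ∈ S) ∨ (e = s(v, v + ![0, 1]) ∧ ((v, (0 : Fin 2)) ∈ S ↔ (v, (1 : Fin 2)) ∉ S))}; let P : unitInterval → Literature.Probability.RandomPlanarGeometry.ConformalRectangle → ℝ → ℝ := fun t R δ => (Literature.Probability.LatticeModels.prodBernoulli (prm t)).real {S | cfg S ∈ Literature.Probability.Percolation.embDomainCrossing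 Literature.Probability.LatticeModels.squareLatticeEmbedding.z R.carrier δ (R.arc 0) (R.arc 2)}; (∀ (R : Literature.Probability.RandomPlanarGeometry.ConformalRectangle) (t₀ : unitInterval), 0 < (t₀ : ℝ) → (t₀ : ℝ) < 1 → ∀ (ε : ℝ), 0 < ε → ∃ ε₀ > 0, ∀ Q : Literature.Probability.RandomPlanarGeometry.ConformalRectangle, (∃ S : Finset (ℂ × ℂ), (∀ p ∈ S, p.1.re = p.2.re ∨ p.1.im = p.2.im) ∧ frontier Q.carrier ⊆ ⋃ p ∈ S, segment ℝ p.1 p.2) → (∀ u : ℝ, dist (Q.boundary u) (R.boundary u) ≤ ε₀) → (∀ i : Fin 4, |Q.mark i - R.mark i| ≤ ε₀) → ∃ δ₀ > 0, ∀ δ : ℝ, 0 < δ → δ < δ₀ → |P t₀ Q δ - P t₀ R δ| ≤ ε)) →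
    (let prm : unitInterval → Literature.Probability.LatticeModels.Site 2 × Fin 2 → unitInterval := fun t i => if i.2 = 0 then Literature.Probability.Percolation.half else Literature.Probability.Percolation.half * t; let cfg : Set (Literature.Probability.LatticeModels.Site 2 × Fin 2) → Literature.Probability.Percolation.BondConfig (Literature.Probability.LatticeModels.Site 2) := fun S => {e | ∃ v : Literature.Probability.LatticeModels.Site 2, (e = s(v, v + ![1, 0]) ∧ (v, (0 : Fin 2)) ∈ S) ∨ (e = s(v, v + ![0, 1]) ∧ ((v, (0 : Fin 2)) ∈ S ↔ (v, (1 : Fin 2)) ∉ S))}; let P : unitInterval → Literature.Probability.RandomPlanarGeometry.ConformalRectangle → ℝ → ℝ := fun t R δ => (Literature.Probability.LatticeModels.prodBernoulli (prm t)).real {S | cfg S ∈ Literature.Probability.Percolation.embDomainCrossing Literature.Probability.LatticeModels.squareLatticeEmbedding.z R.carrier δ (R.arc 0) (R.arc 2)}; (∀ (R : Literature.Probability.RandomPlanarGeometry.ConformalRectangle) (ε : ℝ), 0 < ε → ∃ ε₀ > 0, ∀ Q : Literature.Probability.RandomPlanarGeometry.ConformalRectangle, (∃ S : Finset (ℂ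 × ℂ), (∀ p ∈ S, p.1.re = p.2.re ∨ p.1.im = p.2.im) ∧ frontier Q.carrier ⊆ ⋃ p ∈ S, segment ℝ p.1 p.2) → (∀ u : ℝ, dist (Q.boundary u) (R.boundary u) ≤ ε₀) → (∀ i : Fin 4, |Q.mark i - R.mark i| ≤ ε₀) → ∃ δ₀ > 0, ∀ δ : ℝ, 0 < δ → δ < δ₀ → |P 1 Q δ - P 1 R δ| ≤ ε)) →
    Summit.CriticalPhenomena.CardyFormulaZ2.Theses.CardySelfDualSegment.UniformMarginality := by
  intro h₁ h₂ h₃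
  -- Sub₁ in the line's `Pext` form = stub (B₁) of line `Sketch`
  have hB₁ : ∀ R : ConformalRectangle,
      (∃ S : Finset (ℂ × ℂ), (∀ p ∈ S, p.1.re = p.2.re ∨ p.1.im = p.2.im) ∧
        frontier R.carrier ⊆ ⋃ p ∈ S, segment ℝ p.1 p.2) →
      ∀ t₀ : ℝ, t₀ ∈ Set.Icc (0 : ℝ) 1 → ∀ ε > 0, ∃ η > 0,
        ∀ δ : ℝ, 0 < δ → ∀ t ∈ Set.Icc (0 : ℝ) 1, |t - t₀| < η → |Pext R δ t - Pext R δ t₀| < ε :=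
    uniformMarginalityRect_iff_integratedBoundRectilinear.1 (fun t₀ R hR ε hε => h₁ t₀ R hR ε hε)
  -- Sub₂ in the line's `Pext` form = stub (B₂ᵒ)
  have hint : ∀ (R : ConformalRectangle) (t₀ : ℝ), t₀ ∈ Set.Ioo (0 : ℝ) 1 → ∀ ε : ℝ, 0 < ε →
      ∃ ε₀ > 0, ∀ Q : ConformalRectangle,
        (∃ S : Finset (ℂ × ℂ), (∀ p ∈ S, p.1.re = p.2.re ∨ p.1.im = p.2.im) ∧
          frontier Q.carrier ⊆ ⋃ p ∈ S, segment ℝ p.1 p.2) →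
        (∀ u : ℝ, dist (Q.boundary u) (R.boundary u) ≤ ε₀) → (∀ i : Fin 4, |Q.mark i - R.mark i| ≤ ε₀) →
        ∃ δ₀ > 0, ∀ δ : ℝ, 0 < δ → δ < δ₀ → |Pext Q δ t₀ - Pext R δ t₀| ≤ ε := by
    intro R t₀ ht₀ ε hε
    obtain ⟨ε₀, hε₀, hQ⟩ := h₂ R ⟨t₀, ht₀.1.le, ht₀.2.le⟩ ht₀.1 ht₀.2 ε hε
    refine ⟨ε₀, hε₀, fun Q hS hb hm => ?_⟩
    obtain ⟨δ₀, hδ₀, hδ⟩ := hQ Q hS hb hm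
    refine ⟨δ₀, hδ₀, fun δ hδp hδl => ?_⟩
    have key : |cornerCrossingProb ⟨t₀, ht₀.1.le, ht₀.2.le⟩ Q δ -
        cornerCrossingProb ⟨t₀, ht₀.1.le, ht₀.2.le⟩ R δ| ≤ ε := hδ δ hδp hδl
    rw [← Pext_coe, ← Pext_coe] at key
    exact key
  -- Sub₃ in the line's `Pext` form = stub (N)
  have hone : ∀ (R : ConformalRectangle) (ε : ℝ), 0 < ε → ∃ ε₀ > 0, ∀ Q : ConformalRectangle,
      (∃ S : Finset (ℂ × ℂ), (∀ p ∈ S, p.1.re = p.2.re ∨ p.1.im = p.2.im) ∧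
        frontier Q.carrier ⊆ ⋃ p ∈ S, segment ℝ p.1 p.2) →
      (∀ u : ℝ, dist (Q.boundary u) (R.boundary u) ≤ ε₀) → (∀ i : Fin 4, |Q.mark i - R.mark i| ≤ ε₀) →
      ∃ δ₀ > 0, ∀ δ : ℝ, 0 < δ → δ < δ₀ → |Pext Q δ 1 - Pext R δ 1| ≤ ε := by
    intro R ε hε
    obtain ⟨ε₀, hε₀, hQ⟩ := h₃ R ε hε
    refine ⟨ε₀, hε₀, fun Q hS hb hm => ?_⟩
    obtain ⟨δ₀, hδ₀, hδ⟩ := hQ Q hS hb hm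
    refine ⟨δ₀, hδ₀, fun δ hδp hδl => ?_⟩
    have key : |cornerCrossingProb 1 Q δ - cornerCrossingProb 1 R δ| ≤ ε := hδ δ hδp hδl
    rw [← Pext_coe, ← Pext_coe] at key
    exact key
  exact uniformMarginality_of_integratedBound
    (stub_transportOfUniformSandwich
      (stub_uniformSandwichOfFixedDomainContinuity
        (fixedDomainContinuity_byCases fixedDomainContinuity_zero hone hint) hB₁)
      hB₁)

end Summit.CriticalPhenomena.CardyFormulaZ2.Cruxes.UniformMarginality.HeatFlow.Split

end
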